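import Literature.NumberTheory.EllipticCurves.Greenberg1999.KummerImageGoodOrdinaryNumberField
import HarnessLib

/-!
# Greenberg's canonical datum `C_v` CUT TO A FINITE LEVEL: `C_v[m] = E[m] ∩ E₁(K̄_v)` as a Greenberg local datum on `E[m]`
# (LNM 1716 §2 p. 73, `C_v = ker(E[p^∞] → Ẽ[p^∞]) = 𝓕(𝔪̄)[p^∞]`; its `p^k`-torsion `𝓕(𝔪̄)[p^k]`)

Topic `NumberTheory/EllipticCurves`, namespace = path. ONE DEFINITION WITH BODY (the finite-level twin of the tree's
`WeierstrassCurve.kernelOfReductionLocalDatum W p v : LocalDatum K (W.geomPrimaryTorsion p) v`, file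
`Greenberg1999/KummerImageGoodOrdinaryNumberField`) + its unfolding lemma + the compatibility with the `E[p^∞]`-datum along
`E[p^k] ↪ E[p^∞]`. No named fact, no instance, no `sorry`. Written by seat `bsd-2adic-tower-1` GEN 34 (cell `bsd-2adic`) for the
KERNEL proof of Greenberg's Lemma 4.6 on `Γ`-invariants (`lemma46_gammaInvariants_auxPlace_rat`, road C′, bricks B3-EC / B5 §4): the
levelwise Poitou–Tate call runs on `Maps(Γ_ℚ ⧸ Γ_n, E[p^k])` and its local condition at `p` is Greenberg's STRICT condition for
`C_v[p^k]` (`LocalDatum.strictKer`), transported to `E[p^∞]` by this file's `inclusion_mem_plus_iff`.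

* `WeierstrassCurve.kernelOfReductionLocalDatumTorsion W m v : LocalDatum K (geomTorsion W m) v` — `plus := {P ∈ E[m] : ι P ∈ E₁(K̄_v)}`
  (`W.localKernelOfReduction v` pulled back along `E[m] ⊆ E(K̄) → E(K̄_v)`), `D_v`-stable as in the `E[p^∞]` case
  (`smul_mem_localKernelOfReduction_iff`, `pointsMap_smul`).
* `mem_kernelOfReductionLocalDatumTorsion_plus_iff` (unfolding); `inclusion_mem_kernelOfReductionLocalDatum_plus_iff` — for
  `hle : E[m] ≤ E[p^∞]`: `AddSubgroup.inclusion hle P ∈ C_v ↔ P ∈ C_v[m]` (both are «`ι P ∈ E₁(K̄_v)`»).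

References: [GreenbergLNM1716] §2 p. 73 (`C_v`), Prop. 2.2/2.4 (pp. 73–75); [Greenberg1989] §1 p. 98 (local data `M⁺_v`).
-/

noncomputable section

open scoped Classical

open NumberField IsDedekindDomain Field WeierstrassCurve Literature.NumberTheory.GaloisRepresentations
  Literature.NumberTheory.EllipticCurves Literature.NumberTheory.EllipticCurves.GreenbergSelmer

namespace WeierstrassCurve

variable {K : Type} [Field K] [NumberField K] (W : WeierstrassCurve K) (m : ℤ) (v : HeightOneSpectrum (𝓞 K))

/-- **`C_v[m] = E[m] ∩ E₁(K̄_v)` as a Greenberg local datum on `E[m]`**: the `m`-torsion points of `E(K̄)` whose image in `E(K̄_v)`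
(chosen embedding, `pointsMap`) lies in the kernel of reduction `E₁(K̄_v) = W.localKernelOfReduction v`; `D_v`-stable because `E₁(K̄_v)`
is `Γ_{K_v}`-stable and `E(K̄) → E(K̄_v)` is equivariant. For `m = p^k` this is `𝓕(𝔪̄)[p^k] = C_v[p^k]`, `C_v` Greenberg's ordinary
submodule. [cite: GreenbergLNM1716, §2 p. 73 (C_v = 𝓕(𝔪̄)[p^∞])] [cite: Greenberg1989, §1 p. 98] -/
def kernelOfReductionLocalDatumTorsion : LocalDatum K (geomTorsion W m) v where
  plus := (W.localKernelOfReduction v).comap ((pointsMap W (v.adicCompletion K)).comp (geomTorsion W m).subtype)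
  smul_mem σ {P} hP := by
    rw [AddSubgroup.mem_comap, AddMonoidHom.comp_apply, AddSubgroup.coe_subtype] at hP ⊢
    have h : pointsMap W (v.adicCompletion K)
        (absGaloisRestrict K (v.adicCompletion K) σ • (P : W.geomPoints)) =
        σ • pointsMap W (v.adicCompletion K) (P : W.geomPoints) :=
      pointsMap_smul W _ σ _
    rw [Literature.NumberTheory.EllipticCurves.AddSubgroup.torsionBy.coe_smul, h]
    exact (W.smul_mem_localKernelOfReduction_iff v σ _).2 hP

/-- Membership in `C_v[m]`: `P ∈ C_v[m] ↔ ι P ∈ E₁(K̄_v)`. [cite: GreenbergLNM1716, §2 p. 73] -/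
theorem mem_kernelOfReductionLocalDatumTorsion_plus_iff (P : geomTorsion W m) :
    P ∈ (W.kernelOfReductionLocalDatumTorsion m v).plus ↔
      pointsMap W (v.adicCompletion K) (P : W.geomPoints) ∈ W.localKernelOfReduction v :=
  Iff.rfl

/-- **Compatibility with the `E[p^∞]`-datum**: along an inclusion `E[m] ≤ E[p^∞]` (`m = p^k`), a point of `E[m]` lies in Greenberg's
`C_v = W.kernelOfReductionLocalDatum p v` iff it lies in `C_v[m]` (both conditions read «`ι P ∈ E₁(K̄_v)`» on the same point of `E(K̄)`).
[cite: GreenbergLNM1716, §2 p. 73] -/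
theorem inclusion_mem_kernelOfReductionLocalDatum_plus_iff (p : ℕ) (hle : geomTorsion W m ≤ W.geomPrimaryTorsion p)
    (P : geomTorsion W m) :
    AddSubgroup.inclusion hle P ∈ (W.kernelOfReductionLocalDatum p v).plus ↔
      P ∈ (W.kernelOfReductionLocalDatumTorsion m v).plus :=
  Iff.rfl

end WeierstrassCurve

end
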